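import Literature.Analysis.FluidPDE.StokesTorusProofs
import HarnessLib

/-!
# The Galerkin projections of the torus Stokes operator factor through the Leray projector (proof)

`Literature.Analysis.FluidPDE.StokesTorus` vendors, as the named fact
`Torus.galerkinProj_comp_lerayProjector`, the identity `P_N ∘ P = P_N` between the Galerkin
projections `P_N = Torus.galerkinProj N` (orthogonal projections of `L²(T^d; ℝ^d)` onto
`Torus.galerkinSpace N`, the span of the Stokes modes `cos/sin(2πk·x) a`, `0 < |k| ≤ N`, `a ⊥ k`)
and the Leray projector `P = Torus.lerayProjector d` (orthogonal projection onto the energy space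
`H = Torus.energySpace d`). This file **proves** it (`Torus.galerkinProj_comp_lerayProjector_holds`).

## Source and proof

Constantin–Foias 1988, Ch. 7, (7.4): `P_m f = ∑_{j ≤ m} (w_j, f) w_j` is "the projection in `H` on
the span of `w_1, …, w_m`", the `w_j ∈ H` being the Stokes eigenfunctions (Ch. 4, (4.4)–(4.7); in
the periodic case (4.42) and the paragraph following it). Thus `span{w_1, …, w_m} ⊆ H`, and for the
`L²`-orthogonal projections this gives `P_m P = P_m`: projecting first onto the larger closed
subspace `H` does not change the projection onto a closed subspace of `H`. In the tree,
`galerkinSpace N ≤ H` is the sibling discharge `Torus.galerkinSpace_le_energySpace_holds` of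
`StokesTorusProofs`, and the projection identity is Mathlib's
`Submodule.starProjection_comp_starProjection_of_le`.

## References

* P. Constantin, C. Foias, *Navier–Stokes Equations*, Chicago Lectures in Mathematics, Univ. of
  Chicago Press (1988), Ch. 4, (4.4)–(4.7), (4.42); Ch. 7, (7.4). [ConstantinFoias1988]
* R. Temam, *Navier–Stokes Equations. Theory and Numerical Analysis*, North-Holland (1977),
  Ch. III §3 (Galerkin method).
-/

noncomputable section

namespace Literature.Analysis.FluidPDE

namespace Torus

variable {d : Type*} [Fintype d] [DecidableEq d]

/-- **Discharge of `Torus.galerkinProj_comp_lerayProjector`**: `P_N ∘ P = P_N` for every `N`,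
since `galerkinSpace N ≤ H` (`galerkinSpace_le_energySpace_holds`) and, for complete subspaces
`U ≤ V` of a Hilbert space, `proj_U ∘ proj_V = proj_U` (Mathlib's
`Submodule.starProjection_comp_starProjection_of_le`) (Constantin–Foias 1988, Ch. 7, (7.4): `P_m`
is the projection in `H` onto `span{w_1, …, w_m} ⊆ H`). [cite: ConstantinFoias1988, Ch. 7 (7.4)] -/
theorem galerkinProj_comp_lerayProjector_holds : galerkinProj_comp_lerayProjector (d := d) :=
  fun N => Submodule.starProjection_comp_starProjection_of_le (galerkinSpace_le_energySpace_holds N)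

end Torus

end Literature.Analysis.FluidPDE
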